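import Summits.ABC.IUTFork.Cor312FrameVolumePiecesDHArch
import Summits.ABC.IUTFork.Cor312SettingPrVolArch
import Summits.ABC.IUTFork.Cor312StatementHullSetLocality
import Summits.ABC.IUTFork.Cor312Provenance
import HarnessLib

/-!
# [IUTchIII] Corollary 3.12, statement — the field-box volume pieces, PACKET-NORMALISED AND ARCHIMEDEAN PLACE HONEST,
# and container-robustness with provenance at `Real.settingPrVolArch` (the fourth corner)

Record-only file (D-0012) of the abc-iut cell (Cor. 3.12 sub-crew, seat abc-iut-c312-6, gen 5; TEAM B real-setting lane);
TAKES NO SIDE. The settings of record for [IUTchIII] Cor. 3.12 over the real log-shells form the square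
{Dupuy–Hilado weights, packet-normalised weights} × {trivial `∞`, honest `∞`} (abc-iut-c312-5 `settingDHVol`, abc-iut-c312-1
`settingPrVol`, abc-iut-w5-d163 `settingDHVolArch`, abc-iut-w5-d043 / w5-d163 `settingPrVolArch`), each with the
verbatim summandwise `𝕄(−)`. This seat's companions gave the FIELD-BOX (frames) twin and the robustness theorem
`Statement ↔ Statement` at three corners (p424654 + p424766; p425868; `Cor312FrameVolumePiecesPr`). THIS file is the
fourth: packet-normalised weights at the primes AND radial archimedean factors at `∞` — the twin of
`Real.settingPrVolArch` (`Cor312SettingPrVolArch`, over `Real.situationDHVolPrArch` of `Cor312VolumesRealPrArch`):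

* §1 `Real.frameVolumePiecesPrArch X hlog hc` — the arch-honest pieces `frameVolumePiecesDHArch` (p425868: w5-d163's
  frames, `complexRadial` on the copies of `ℂ` with weights `|J|⁻¹`, Haar at the primes) with the prime weights replaced
  by `Pr(v⃗)/D_{v⃗}` (abc-iut-c312-1's `presAtPr`; p424654's generic `PadicPresentation.frameWeight`);
* §2 AGREEMENT ON HULL-SETS with `Real.summandPiecesPrArch` at every place: at `∞` the two containers are literally
  those of the arch-honest companion (p425868 `logvol_situationDHVolArch_preimage_hullSet_inl`, by `rfl` on both sides),
  at a prime p424654's generic `sum_frameWeight_mul_mulLogvol` at `presAtPr`;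
* §3 twin `Real.situationPrFramesArch`/`Real.settingPrFramesArch` (c312-7 `Setting.ofFrames`, `hadm` DISCHARGED,
  binders EXACTLY those of `Real.settingPrVolArch`) and, by the generic hull-set locality theorem (p427194), the same
  `qLocal`/`thetaLocal`/`negLogTheta`/`negLogQ` and **`statement_settingPrFramesArch_iff`**; §4 abc-iut-c312-8's
  provenance `IsSettingOf D` transfers (`isSettingOf_settingPrFramesArch_iff`).
With this file every corner of the square carries the kernel fact «the typed Cor. 3.12 (and its provenance link) does
not depend on reading `𝕄(−)` summandwise or as field-boxes» — all four as instances of ONE theorem (p427194).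
[claim: Mochizuki2012, status: disputed] for the quoted setting; [cite: MochizukiAbsTopIII2015, Prop. 5.7 (i)(ii) pp. 137–138];
[cite: DupuyHilado2025, §3.6]. Bookkeeping only. Typed ≠ proved; instantiated ≠ endorsed.
-/

noncomputable section

open Set Function NumberField

namespace Summit.ABC

namespace IUTFork

namespace Thm311

namespace Real

open Cor312 Cor312Vol Cor312Prov Literature.IUT.LogThetaLattice Literature.IUT.LogVolume Literature.IUT.HodgeTheaters

variable {F : Type} [Field F] [NumberField F] (X : PilotData F) {logv : PadicLogs F} (hlog : LogvAnalytic logv)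
  (hc : ∀ w : InfinitePlace F, w.IsComplex)

/-! ## §1. The pieces: packet-normalised weights at the primes, radial archimedean factors -/

/-- The frame weights: `|J|⁻¹` on every copy of `ℂ` at `∞` (as in the arch-honest companion), `Pr(v⃗)/D_{v⃗}` at a prime
(abc-iut-c312-1's probability-weighted presentation). [cite: Mochizuki2012, IUTchIII Prop. 3.9 (i) p. 115] -/
def frameWeightPrArch : ∀ (j : (thetaIndex X).Label) (vQ : (thetaIndex X).VQ), factorIdxDHArch X hlog j vQ → ℝ
  | j, .inl u => fun _ => ((Fintype.card (factorIdxDHArch X hlog j (.inl u)) : ℝ))⁻¹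
  | j, .inr pp => by
    haveI : Fact (pp : ℕ).Prime := ⟨pp.2⟩
    exact fun s => (presAtPr X hlog pp).frameWeight j s

/-- The frame weights are nonnegative. [folklore] -/
theorem frameWeightPrArch_nonneg : ∀ (j : (thetaIndex X).Label) (vQ : (thetaIndex X).VQ)
    (s : factorIdxDHArch X hlog j vQ), 0 ≤ frameWeightPrArch X hlog j vQ s
  | _, .inl _, _ => inv_nonneg.mpr (Nat.cast_nonneg _)
  | j, .inr pp, s => by
    haveI : Fact (pp : ℕ).Prime := ⟨pp.2⟩
    exact (presAtPr X hlog pp).frameWeight_nonneg j s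

/-- **The field-box volume pieces of the real log-shells, packet-normalised at the primes and RADIAL at `∞`**: the
arch-honest companion's `frameVolumePiecesDHArch` (w5-d163's frames and comparison, `complexRadial` / Haar factor
volumes) re-weighted at the primes by `Pr(v⃗)/D_{v⃗}`. [claim: Mochizuki2012, status: disputed] -/
def frameVolumePiecesPrArch : FrameVolumePieces (logShellsDH X logv) :=
  { frameVolumePiecesDHArch X hlog hc with
    w := frameWeightPrArch X hlog
    w_nonneg := frameWeightPrArch_nonneg X hlog }

/-- Its comparison is w5-d163's `factorMapDHArch`. [folklore] -/
theorem frameVolumePiecesPrArch_e : (frameVolumePiecesPrArch X hlog hc).e = factorMapDHArch X hlog hc := rfl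

/-- The pieces for the ANALYTIC logarithm family — no hypothesis beyond `X` and "`√−1 ∈ F`".
[claim: Mochizuki2012, status: disputed] -/
def frameVolumePiecesPrArchAnalytic : FrameVolumePieces (logShellsDH X (analyticLogv F)) :=
  frameVolumePiecesPrArch X (logvAnalytic_analyticLogv (F := F)) hc

/-! ## §2. Agreement with the print-normalised arch-honest verbatim container on hull-sets -/

section Agreement

variable (M : Type) [Field M] [NumberField M]
  (archPk : ∀ (j : (thetaIndex X).Label) (vQ : (thetaIndex X).VQ), Set ((logShellsDH X logv).Packet j vQ))
  (archSub : ∀ (j : (thetaIndex X).Label) (v : (thetaIndex X).V),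
    Set ((logShellsDH X logv).Packet j ((thetaIndex X).over v)))
  (Ψ : ℤ → ∀ v : (thetaIndex X).V, v ∈ (thetaIndex X).Vbad → Set ((logShellsDH X logv).StarPacket v))
  (act : ℤ → ∀ v : (thetaIndex X).V, v ∈ (thetaIndex X).Vbad →
    (logShellsDH X logv).StarPacket v → Module.End ℚ ((logShellsDH X logv).StarPacket v))
  (Mmod : ℤ → ∀ j : (thetaIndex X).LabelStar, Set ((logShellsDH X logv).GlobalPacket j.1))
  (region : ℤ → ∀ j : (thetaIndex X).LabelStar, FinDivisor M → ∀ vQ : (thetaIndex X).VQ,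
    Set ((logShellsDH X logv).Packet j.1 vQ))
  (n : ℤ)

/-- **Field-box log-volume = the print-normalised arch-honest verbatim container on hull-set preimages, at EVERY place**
(for `λ_s ≠ 0`): at `∞` both sides are those of the arch-honest companion (p425868), at a prime p424654's generic closed
form at `presAtPr`. [claim: Mochizuki2012, status: disputed] [cite: MochizukiAbsTopIII2015, Prop. 5.7 (i)(ii) pp. 137–138] -/
theorem logvol_frameVolumePiecesPrArch_preimage_hullSet : ∀ (j : (thetaIndex X).Label) (vQ : (thetaIndex X).VQ)
    (c : ∀ s : factorIdxDHArch X hlog j vQ, factorFieldDHArch X hlog j vQ s), (∀ s, c s ≠ 0) →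
    (frameVolumePiecesPrArch X hlog hc).logvol j vQ
        (factorMapDHArch X hlog hc j vQ ⁻¹' hullSet (factorFieldDHArch X hlog j vQ) c) =
      ((situationDHVolPrArch X hlog hc M archPk archSub Ψ act Mmod region).D n).logvol j vQ
        (factorMapDHArch X hlog hc j vQ ⁻¹' hullSet (factorFieldDHArch X hlog j vQ) c)
  | j, .inl u, c, hc0 => by
    cases u
    have h1 : (frameVolumePiecesPrArch X hlog hc).logvol j (.inl ())
        (factorMapDHArch X hlog hc j (.inl ()) ⁻¹' hullSet (factorFieldDHArch X hlog j (.inl ())) c) =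
        ((Fintype.card (factorIdxDHArch X hlog j (.inl ())) : ℝ))⁻¹ * ∑ s, Real.log ‖c s‖ :=
      logvol_frameVolumePiecesDHArch_preimage_hullSet_inl X hlog hc j c
    have h2 : ((situationDHVolPrArch X hlog hc M archPk archSub Ψ act Mmod region).D n).logvol j (.inl ())
        (factorMapDHArch X hlog hc j (.inl ()) ⁻¹' hullSet (factorFieldDHArch X hlog j (.inl ())) c) =
        ((Fintype.card (factorIdxDHArch X hlog j (.inl ())) : ℝ))⁻¹ * ∑ s, Real.log ‖c s‖ :=
      logvol_situationDHVolArch_preimage_hullSet_inl X hlog hc M archPk archSub Ψ act Mmod region n j c hc0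
    rw [h1, h2]
  | j, .inr pp, c, hc0 => by
    haveI : Fact (pp : ℕ).Prime := ⟨pp.2⟩
    letI hCF : Fintype ((thetaIndex X).Caps j → (thetaIndex X).Fibre (.inr pp)) := Fintype.ofFinite _
    rw [show factorMapDHArch X hlog hc j (.inr pp) ⁻¹' hullSet (factorFieldDHArch X hlog j (.inr pp)) c =
        (frameVolumePiecesPrArch X hlog hc).e j (.inr pp) ⁻¹' hullSet ((frameVolumePiecesPrArch X hlog hc).K j (.inr pp)) c
        from rfl, (frameVolumePiecesPrArch X hlog hc).logvol_preimage_hullSet j (.inr pp) c]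
    show (∑ s : (presAtPr X hlog pp).factorIdx j, (presAtPr X hlog pp).frameWeight j s *
        ((presAtPr X hlog pp).factorVolume j s).mulLogvol (c s)) =
      ((situationDHVolPrArch X hlog hc M archPk archSub Ψ act Mmod region).D n).logvol j (.inr pp)
        (factorMapDHArch X hlog hc j (.inr pp) ⁻¹' hullSet (factorFieldDHArch X hlog j (.inr pp)) c)
    exact (presAtPr X hlog pp).sum_frameWeight_mul_mulLogvol j c hc0

/-- The same for an arbitrary hull-set `H = λ·𝒪_L`. [claim: Mochizuki2012, status: disputed] -/
theorem logvol_frameVolumePiecesPrArch_preimage_of_isHullSet (j : (thetaIndex X).Label) (vQ : (thetaIndex X).VQ)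
    {H : Set (∀ s : factorIdxDHArch X hlog j vQ, factorFieldDHArch X hlog j vQ s)}
    (hH : IsHullSet (factorFieldDHArch X hlog j vQ) H) :
    (frameVolumePiecesPrArch X hlog hc).logvol j vQ (factorMapDHArch X hlog hc j vQ ⁻¹' H) =
      ((situationDHVolPrArch X hlog hc M archPk archSub Ψ act Mmod region).D n).logvol j vQ
        (factorMapDHArch X hlog hc j vQ ⁻¹' H) := by
  obtain ⟨c, hc0, rfl⟩ := hH
  exact logvol_frameVolumePiecesPrArch_preimage_hullSet X hlog hc M archPk archSub Ψ act Mmod region n j vQ c hc0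

/-! ## §3. The twin setting and container-robustness (via hull-set locality) -/

/-- The situation of Thm. 3.11 over the real log-shells with the field-box volumes, packet-normalised and arch-honest.
[claim: Mochizuki2012, status: disputed] -/
abbrev situationPrFramesArch : Situation (thetaIndex X) :=
  Situation.ofShells (logShellsDH X logv) M archPk archSub (frameVolumePiecesPrArch X hlog hc).Adm
    (frameVolumePiecesPrArch X hlog hc).logvol Ψ act Mmod region

/-- Every line of `situationPrFramesArch` carries the pieces' volumes (by `rfl`). [folklore] -/
theorem realizes_situationPrFramesArch :
    (frameVolumePiecesPrArch X hlog hc).Realizes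
      ((situationPrFramesArch X hlog hc M archPk archSub Ψ act Mmod region).D n) :=
  ⟨fun _ _ _ => Iff.rfl, fun _ _ _ => rfl⟩

variable {HT : Type} {LogLink : HT → HT → Type} {IsFull : ∀ {s t : HT}, LogLink s t → Prop}
  (lat : LGPGaussianLogThetaLattice LogLink IsFull)
  {Frd : Type} {IsoF : Frd → Frd → Type} {Ob : Frd → Type} {realify : Frd → Frd} {Strip : Type}
  {IsoS : Strip → Strip → Type} {Mv : ∀ v : (thetaIndex X).V, v ∈ (thetaIndex X).Vbad → Type}
  [∀ v h, Monoid (Mv v h)]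
  (sig : GlobalLGPFrobenioidSignature (thetaIndex X).lstar (thetaIndex X).V (· ∈ (thetaIndex X).Vbad)
    Frd IsoF Ob realify Strip IsoS Mv)
  (split : SplittingMonoids Mv) {ObΔ : Type} {N : ∀ v : (thetaIndex X).V, v ∈ (thetaIndex X).Vbad → Type}
  [∀ v h, Monoid (N v h)] (qData : QPilotData ObΔ N)
  (thetaBox : ℤ → Ob sig.Clgp → ∀ (j : (thetaIndex X).Label) (vQ : (thetaIndex X).VQ),
    Set (∀ s : factorIdxDHArch X hlog j vQ, factorFieldDHArch X hlog j vQ s))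
  (qCentre : ObΔ → ∀ (j : (thetaIndex X).Label) (vQ : (thetaIndex X).VQ),
    ∀ s : factorIdxDHArch X hlog j vQ, factorFieldDHArch X hlog j vQ s)
  (hq : ∀ j vQ s, qCentre (qPilotObject qData) j vQ s ≠ 0)
  (hfin : ∀ j : (thetaIndex X).Label, (Function.support fun vQ =>
    ((situationDHVolPrArch X hlog hc M archPk archSub Ψ act Mmod region).D n).logvol j vQ
      (factorMapDHArch X hlog hc j vQ ⁻¹' hullSet (factorFieldDHArch X hlog j vQ) (qCentre (qPilotObject qData) j vQ))).Finite)

include hq in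
/-- The `q`-supports agree, so `Real.settingPrVolArch`'s binder `hfin` serves both containers. [folklore] -/
theorem qSupport_framesPrArch_eq (j : (thetaIndex X).Label) :
    (Function.support fun vQ => ((situationPrFramesArch X hlog hc M archPk archSub Ψ act Mmod region).D n).logvol j vQ
      (factorMapDHArch X hlog hc j vQ ⁻¹' hullSet (factorFieldDHArch X hlog j vQ) (qCentre (qPilotObject qData) j vQ))) =
    (Function.support fun vQ => ((situationDHVolPrArch X hlog hc M archPk archSub Ψ act Mmod region).D n).logvol j vQ
      (factorMapDHArch X hlog hc j vQ ⁻¹' hullSet (factorFieldDHArch X hlog j vQ) (qCentre (qPilotObject qData) j vQ))) := by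
  ext vQ
  simp only [Function.mem_support, ne_eq]
  rw [show ((situationPrFramesArch X hlog hc M archPk archSub Ψ act Mmod region).D n).logvol j vQ
      (factorMapDHArch X hlog hc j vQ ⁻¹' hullSet (factorFieldDHArch X hlog j vQ) (qCentre (qPilotObject qData) j vQ)) =
      (frameVolumePiecesPrArch X hlog hc).logvol j vQ
        (factorMapDHArch X hlog hc j vQ ⁻¹' hullSet (factorFieldDHArch X hlog j vQ) (qCentre (qPilotObject qData) j vQ))
      from rfl,
    logvol_frameVolumePiecesPrArch_preimage_hullSet X hlog hc M archPk archSub Ψ act Mmod region n j vQ _ (hq j vQ)]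

/-- **The setting of [IUTchIII] Cor. 3.12 over the real log-shells with field-box volumes, packet-normalised and
arch-honest** — c312-7's `Setting.ofFrames`, `hadm` DISCHARGED (`hadm_of_realizes`), binders EXACTLY those of
`Real.settingPrVolArch`. [claim: Mochizuki2012, status: disputed] -/
def settingPrFramesArch : Cor312.Setting (situationPrFramesArch X hlog hc M archPk archSub Ψ act Mmod region) :=
  Setting.ofFrames n lat sig split qData
    (FrameVolumePieces.toRealFrames (S := situationPrFramesArch X hlog hc M archPk archSub Ψ act Mmod region)
      (frameVolumePiecesPrArch X hlog hc) thetaBox qCentre) hq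
    (FrameVolumePieces.hadm_of_realizes (S := situationPrFramesArch X hlog hc M archPk archSub Ψ act Mmod region)
      (V := frameVolumePiecesPrArch X hlog hc)
      (realizes_situationPrFramesArch X hlog hc M archPk archSub Ψ act Mmod region n))
    (fun j => (qSupport_framesPrArch_eq X hlog hc M archPk archSub Ψ act Mmod region n qData qCentre hq j).symm ▸ hfin j)

/-- Same hull frames as `Real.settingPrVolArch` (both `Setting.ofFrames` over w5-d163's frames). [folklore] -/
theorem frame_settingPrFramesArch : ∀ (j : (thetaIndex X).Label) (vQ : (thetaIndex X).VQ),
    (settingPrFramesArch X hlog hc M archPk archSub Ψ act Mmod region n lat sig split qData thetaBox qCentre hq hfin).frame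
        j vQ =
      (settingPrVolArch X hlog hc M archPk archSub Ψ act Mmod region n lat sig split qData thetaBox qCentre hq hfin).frame
        j vQ :=
  fun _ _ => rfl

/-- Same (Ind3)-enlarged Θ-regions as `Real.settingPrVolArch`. [folklore] -/
theorem thetaRegion3_settingPrFramesArch : ∀ (j : (thetaIndex X).Label) (vQ : (thetaIndex X).VQ),
    (settingPrFramesArch X hlog hc M archPk archSub Ψ act Mmod region n lat sig split qData thetaBox qCentre hq
        hfin).thetaRegion3 j vQ =
      (settingPrVolArch X hlog hc M archPk archSub Ψ act Mmod region n lat sig split qData thetaBox qCentre hq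
        hfin).thetaRegion3 j vQ :=
  fun _ _ => rfl

/-- Same `q`-pilot regions as `Real.settingPrVolArch`. [folklore] -/
theorem qRegion_settingPrFramesArch : ∀ (j : (thetaIndex X).Label) (vQ : (thetaIndex X).VQ),
    (settingPrFramesArch X hlog hc M archPk archSub Ψ act Mmod region n lat sig split qData thetaBox qCentre hq
        hfin).qRegion j vQ =
      (settingPrVolArch X hlog hc M archPk archSub Ψ act Mmod region n lat sig split qData thetaBox qCentre hq
        hfin).qRegion j vQ :=
  fun _ _ => rfl

/-- The two log-volumes agree on every hull-set of every frame of `settingPrFramesArch` (§2). [folklore] -/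
theorem logvol_agree_on_hul_settingPrFramesArch (j : (thetaIndex X).Label) (vQ : (thetaIndex X).VQ) :
    ∀ H ∈ ((settingPrFramesArch X hlog hc M archPk archSub Ψ act Mmod region n lat sig split qData thetaBox qCentre hq
      hfin).frame j vQ).Hul,
      (frameVolumePiecesPrArch X hlog hc).logvol j vQ H = (summandPiecesPrArch X hlog hc).logvol j vQ H := by
  rintro _ ⟨H', hH', rfl⟩
  exact logvol_frameVolumePiecesPrArch_preimage_of_isHullSet X hlog hc M archPk archSub Ψ act Mmod region n j vQ
    ((frameKDHArch_hul_iff X hlog j vQ H').mp hH')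

/-- **Same local `q`-volume** as `Real.settingPrVolArch` (hull-set locality, p427194). [claim: Mochizuki2012, status: disputed] -/
theorem qLocal_settingPrFramesArch (j : (thetaIndex X).Label) (vQ : (thetaIndex X).VQ) :
    (settingPrFramesArch X hlog hc M archPk archSub Ψ act Mmod region n lat sig split qData thetaBox qCentre hq
        hfin).qLocal j vQ =
      (settingPrVolArch X hlog hc M archPk archSub Ψ act Mmod region n lat sig split qData thetaBox qCentre hq
        hfin).qLocal j vQ :=
  HullSetLocality.qLocal_eq
    (qRegion_settingPrFramesArch X hlog hc M archPk archSub Ψ act Mmod region n lat sig split qData thetaBox qCentre hq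
      hfin)
    (logvol_agree_on_hul_settingPrFramesArch X hlog hc M archPk archSub Ψ act Mmod region n lat sig split qData thetaBox
      qCentre hq hfin) j vQ

/-- **Same local `−|log(Θ)|`** as `Real.settingPrVolArch`. [claim: Mochizuki2012, status: disputed] -/
theorem thetaLocal_settingPrFramesArch (j : (thetaIndex X).Label) (vQ : (thetaIndex X).VQ) :
    (settingPrFramesArch X hlog hc M archPk archSub Ψ act Mmod region n lat sig split qData thetaBox qCentre hq
        hfin).thetaLocal j vQ =
      (settingPrVolArch X hlog hc M archPk archSub Ψ act Mmod region n lat sig split qData thetaBox qCentre hq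
        hfin).thetaLocal j vQ :=
  HullSetLocality.thetaLocal_eq
    (frame_settingPrFramesArch X hlog hc M archPk archSub Ψ act Mmod region n lat sig split qData thetaBox qCentre hq hfin)
    (thetaRegion3_settingPrFramesArch X hlog hc M archPk archSub Ψ act Mmod region n lat sig split qData thetaBox qCentre
      hq hfin)
    (logvol_agree_on_hul_settingPrFramesArch X hlog hc M archPk archSub Ψ act Mmod region n lat sig split qData thetaBox
      qCentre hq hfin) j vQ

/-- **Same `−|log(Θ)|`** as `Real.settingPrVolArch`. [claim: Mochizuki2012, status: disputed] -/
theorem negLogTheta_settingPrFramesArch :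
    (settingPrFramesArch X hlog hc M archPk archSub Ψ act Mmod region n lat sig split qData thetaBox qCentre hq
        hfin).negLogTheta =
      (settingPrVolArch X hlog hc M archPk archSub Ψ act Mmod region n lat sig split qData thetaBox qCentre hq
        hfin).negLogTheta :=
  HullSetLocality.negLogTheta_eq
    (frame_settingPrFramesArch X hlog hc M archPk archSub Ψ act Mmod region n lat sig split qData thetaBox qCentre hq hfin)
    (thetaRegion3_settingPrFramesArch X hlog hc M archPk archSub Ψ act Mmod region n lat sig split qData thetaBox qCentre
      hq hfin)
    (logvol_agree_on_hul_settingPrFramesArch X hlog hc M archPk archSub Ψ act Mmod region n lat sig split qData thetaBox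
      qCentre hq hfin)

/-- **Same `−|log(q)|`** as `Real.settingPrVolArch`. [claim: Mochizuki2012, status: disputed] -/
theorem negLogQ_settingPrFramesArch :
    (settingPrFramesArch X hlog hc M archPk archSub Ψ act Mmod region n lat sig split qData thetaBox qCentre hq
        hfin).negLogQ =
      (settingPrVolArch X hlog hc M archPk archSub Ψ act Mmod region n lat sig split qData thetaBox qCentre hq
        hfin).negLogQ :=
  HullSetLocality.negLogQ_eq
    (qRegion_settingPrFramesArch X hlog hc M archPk archSub Ψ act Mmod region n lat sig split qData thetaBox qCentre hq
      hfin)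
    (logvol_agree_on_hul_settingPrFramesArch X hlog hc M archPk archSub Ψ act Mmod region n lat sig split qData thetaBox
      qCentre hq hfin)

/-- **CONTAINER-ROBUSTNESS AT THE PRINT-NORMALISED ARCH-HONEST SETTING.** The typed [IUTchIII] Cor. 3.12
(`Cor312.Setting.Statement`, p. 174 l. 16–18) holds for the real log-shells of `F` with packet-normalised field-box
volumes and radial archimedean factors iff it holds for `Real.settingPrVolArch` — same binders; an instance of the
hull-set locality theorem (p427194). Neither side asserted. [claim: Mochizuki2012, status: disputed] -/
theorem statement_settingPrFramesArch_iff :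
    (settingPrFramesArch X hlog hc M archPk archSub Ψ act Mmod region n lat sig split qData thetaBox qCentre hq
        hfin).Statement ↔
      (settingPrVolArch X hlog hc M archPk archSub Ψ act Mmod region n lat sig split qData thetaBox qCentre hq
        hfin).Statement :=
  HullSetLocality.statement_iff_of_agree
    (frame_settingPrFramesArch X hlog hc M archPk archSub Ψ act Mmod region n lat sig split qData thetaBox qCentre hq hfin)
    (thetaRegion3_settingPrFramesArch X hlog hc M archPk archSub Ψ act Mmod region n lat sig split qData thetaBox qCentre
      hq hfin)
    (qRegion_settingPrFramesArch X hlog hc M archPk archSub Ψ act Mmod region n lat sig split qData thetaBox qCentre hq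
      hfin)
    (logvol_agree_on_hul_settingPrFramesArch X hlog hc M archPk archSub Ψ act Mmod region n lat sig split qData thetaBox
      qCentre hq hfin)

/-! ## §4. Provenance transfers -/

variable {K Fbar : Type} [Field K] [NumberField K] [Algebra F K] [Field Fbar] [Algebra F Fbar] [Algebra K Fbar]
  {E : WeierstrassCurve F} [E.IsElliptic] {l : ℕ} {Pb : BadPlacePredicates K} {D : InitialThetaData F K Fbar E l Pb}

/-- **`IsSettingOf D` TRANSFERS** between the two readings of `𝕄(−)` at the print-normalised arch-honest setting (index
clauses on the common `thetaIndex X`; `q`-number clause by `negLogQ_settingPrFramesArch`).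
[claim: Mochizuki2012, status: disputed] -/
theorem isSettingOf_settingPrFramesArch_iff :
    IsSettingOf D (settingPrFramesArch X hlog hc M archPk archSub Ψ act Mmod region n lat sig split qData thetaBox qCentre
      hq hfin) ↔
    IsSettingOf D (settingPrVolArch X hlog hc M archPk archSub Ψ act Mmod region n lat sig split qData thetaBox qCentre hq
      hfin) := by
  constructor
  · intro h
    exact ⟨h.lstar_eq, h.places, h.VFbad_finite, by
      rw [← negLogQ_settingPrFramesArch X hlog hc M archPk archSub Ψ act Mmod region n lat sig split qData thetaBox qCentre
        hq hfin]
      exact h.negLogQ_eq⟩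
  · intro h
    exact ⟨h.lstar_eq, h.places, h.VFbad_finite, by
      rw [negLogQ_settingPrFramesArch X hlog hc M archPk archSub Ψ act Mmod region n lat sig split qData thetaBox qCentre hq
        hfin]
      exact h.negLogQ_eq⟩

end Agreement

end Real

end Thm311

end IUTFork

end Summit.ABC

end
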